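/-
Copyright (c) 2026. Released under the Apache 2.0 license.
-/
import Literature.NumberTheory.EllipticCurves.LatticeIndexTwoHalfPeriodProofs
import Literature.NumberTheory.EllipticCurves.WeierstrassPMultiplication
import HarnessLib

/-!
# Index-three superlattices: Vélu's `3`-isogeny on the analytic side (the superlattice with Vélu's invariants is `Λ + ℤz₀`)

Topic `NumberTheory/EllipticCurves`; a proofs-only file (theorems only: no definitions, no named facts) in
`namespace PeriodPair`, the degree-`3` companion of `LatticeIndexTwoHalfPeriodProofs.lean` (`lattice_eq_of_velu_invariants`).

For a third-period `z₀` of `Λ` (`z₀ ∉ Λ`, `3z₀ ∈ Λ`) with `x₀ = ℘_Λ(z₀)` — a root of the `3`-division polynomial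
`Ψ₃(x) = 3x⁴ − (3/2)g₂x² − 3g₃x − g₂²/16` of `Y² = 4X³ − g₂X − g₃` — the quotient of `ℂ/Λ` by the subgroup `{0, ±z₀}` is
`ℂ/(Λ + ℤz₀)`, and `℘_{Λ+ℤz₀}(z) = ℘(z) + ℘(z − z₀) + ℘(z + z₀) − 2℘(z₀) = P(℘ z)/Q(℘ z)` with `Q = (X − x₀)²`,
`P = X³ − 2x₀X² + (7x₀² − g₂/2)X − (2x₀³ + g₂x₀/2 + g₃)` (addition theorem), while Vélu's formulae (Silverman *AEC* III.4.12–13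
for `y² = x³ + ax + b`, `a = −g₂/4`, `b = −g₃/4`, kernel `{O, ±T}`, `t = 6x₀² + 2a`, `w = 10x₀³ + 6ax₀ + 4b`, `a' = a − 5t`,
`b' = b − 7w`) give the invariants of the quotient: `g₂″ = 120x₀² − 9g₂`, `g₃″ = 280x₀³ − 42g₂x₀ − 27g₃`.  Proved here:

* `velu_three_transformation_polynomial_identity` — the algebraic certificate
  `(P′Q − PQ′)²(4X³ − g₂X − g₃) = Q(4P³ − g₂″PQ² − g₃″Q³)` modulo `Ψ₃(x₀) = 0` (a polynomial identity; the multiplier was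
  found by computer algebra, compute job j309830, and is checked by `linear_combination`);
* `twelve_mul_weierstrassP_pow_four_sub_eq_zero_of_three_mul_mem` — `Ψ₃(℘(z₀)) = 0` for a third-period (from the tree's
  `eval_ΨSq_weierstrassP_eq_zero_iff`);
* `lattice_eq_of_velu_three_invariants` — **Vélu's lattice at `3`**: if `Λ″` is any period lattice with the Vélu invariants
  `g₂″, g₃″` above, then `Λ ⊆ Λ″`, `z₀ ∈ Λ″`, and `Λ″ ⊆ Λ ∪ (z₀ + Λ) ∪ (−z₀ + Λ)` — i.e. `Λ″ = Λ + ℤz₀`, the analytic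
  `3`-isogeny with kernel `⟨z₀⟩` (the analytic half of the dictionary «`3`-isogeny with kernel `⟨T⟩` ↔ index-`3`
  superlattice», used with `exists_ratCast_eq_weierstrassP_of_index_three` on the Γ₀/Γ₁ Manin ledger at `9 ∣ N`).

## References
* J. H. Silverman, *The Arithmetic of Elliptic Curves*, 2nd ed., GTM 106: III.4.12–4.13 (Vélu's formulae), Thm. VI.4.1,
  Exercise 3.7 (division polynomials). [SilvermanAEC2009]
* J. Vélu, *Isogénies entre courbes elliptiques*, C. R. Acad. Sci. Paris 273 (1971), 238–241. [Velu1971]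
* D. F. Lawden, *Elliptic Functions and Applications*: §9.8 (transformation of `℘` under a lattice inclusion). [Lawden1989]
-/

noncomputable section

open Complex Set Polynomial Filter Topology
open Literature.NumberTheory.EllipticCurves

namespace PeriodPair

variable (L : PeriodPair)

/-! ### The certificate -/

omit L in
/-- **The algebraic certificate of the `3`-isogeny transformation.**  With `h = g₂/2`, `x₀` a root of
`12x⁴ − 12hx² − 12g₃x − h²` (`= 4Ψ₃`), `P = X³ − 2x₀X² + (7x₀² − h)X − (2x₀³ + hx₀ + g₃)`, `Q = (X − x₀)²` and the Vélu
invariants `g₂″ = 120x₀² − 18h`, `g₃″ = 280x₀³ − 84hx₀ − 27g₃`: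
`(P′Q − PQ′)²(4X³ − 2hX − g₃) = Q(4P³ − g₂″PQ² − g₃″Q³)` — the difference is `(X − x₀)⁴(…)·Ψ₃(x₀)`.
[cite: SilvermanAEC2009, III.4.12–4.13 (Vélu) with Exercise 3.7] [cite: Lawden1989, §9.8] -/
theorem velu_three_transformation_polynomial_identity {x₀ h g₃ g₂'' g₃'' : ℂ}
    (hψ : 12 * x₀ ^ 4 - 12 * h * x₀ ^ 2 - 12 * g₃ * x₀ - h ^ 2 = 0)
    (h₂ : g₂'' = 120 * x₀ ^ 2 - 18 * h) (h₃ : g₃'' = 280 * x₀ ^ 3 - 84 * h * x₀ - 27 * g₃) :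
    (derivative (X ^ 3 - C (2 * x₀) * X ^ 2 + C (7 * x₀ ^ 2 - h) * X - C (2 * x₀ ^ 3 + h * x₀ + g₃)) * (X - C x₀) ^ 2 -
        (X ^ 3 - C (2 * x₀) * X ^ 2 + C (7 * x₀ ^ 2 - h) * X - C (2 * x₀ ^ 3 + h * x₀ + g₃)) *
          derivative ((X - C x₀) ^ 2)) ^ 2 * (4 * X ^ 3 - C (2 * h) * X - C g₃) =
      (X - C x₀) ^ 2 * (4 * (X ^ 3 - C (2 * x₀) * X ^ 2 + C (7 * x₀ ^ 2 - h) * X - C (2 * x₀ ^ 3 + h * x₀ + g₃)) ^ 3 -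
        C g₂'' * (X ^ 3 - C (2 * x₀) * X ^ 2 + C (7 * x₀ ^ 2 - h) * X - C (2 * x₀ ^ 3 + h * x₀ + g₃)) *
          ((X - C x₀) ^ 2) ^ 2 - C g₃'' * ((X - C x₀) ^ 2) ^ 3) := by
  have hd1 : derivative (X ^ 3 - C (2 * x₀) * X ^ 2 + C (7 * x₀ ^ 2 - h) * X - C (2 * x₀ ^ 3 + h * x₀ + g₃) : ℂ[X]) =
      C 3 * X ^ 2 - C (2 * x₀) * (C 2 * X) + C (7 * x₀ ^ 2 - h) := by
    rw [derivative_sub, derivative_add, derivative_sub, derivative_X_pow, derivative_C_mul, derivative_X_pow,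
      derivative_C_mul, derivative_X, derivative_C, mul_one, sub_zero]
    simp only [map_ofNat, Nat.cast_ofNat]
    norm_num
  have hd2 : derivative ((X - C x₀) ^ 2 : ℂ[X]) = C 2 * (X - C x₀) := by
    rw [derivative_pow, derivative_sub, derivative_X, derivative_C, sub_zero, mul_one]
    simp only [Nat.cast_ofNat, map_ofNat]
    ring
  have hψC : (12 : ℂ[X]) * C x₀ ^ 4 - 12 * C h * C x₀ ^ 2 - 12 * C g₃ * C x₀ - C h ^ 2 = 0 := by
    have e := congrArg C hψ
    simpa only [map_sub, map_mul, map_pow, map_ofNat, map_zero] using e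
  rw [h₂, h₃, hd1, hd2]
  simp only [map_add, map_sub, map_mul, map_pow, map_ofNat]
  linear_combination ((X - C x₀) ^ 4 * (-6 * X ^ 3 + 18 * C x₀ * X ^ 2 - (2 * C h + 6 * C x₀ ^ 2) * X -
      4 * C h * C x₀ - 3 * C g₃ + 6 * C x₀ ^ 3)) * hψC

/-! ### A third-period value is a root of `Ψ₃` -/

/-- For a third-period `z₀` (`z₀ ∉ Λ`, `3z₀ ∈ Λ`), `x₀ = ℘_Λ(z₀)` satisfies `12x₀⁴ − 6g₂x₀² − 12g₃x₀ − g₂²/4 = 0` (`= 4Ψ₃(x₀)`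
for `Y² = 4X³ − g₂X − g₃`): the `3`-division polynomial of `E_Λ` vanishes at `℘(z₀)`.
[cite: SilvermanAEC2009, Exercise 3.7(f)] -/
theorem twelve_mul_weierstrassP_pow_four_sub_eq_zero_of_three_mul_mem {z₀ : ℂ} (hz₀ : z₀ ∉ L.lattice)
    (h3 : 3 * z₀ ∈ L.lattice) :
    12 * ℘[L] z₀ ^ 4 - 6 * L.g₂ * ℘[L] z₀ ^ 2 - 12 * L.g₃ * ℘[L] z₀ - L.g₂ ^ 2 / 4 = 0 := by
  have hΨ : (L.curve.ΨSq 3).eval (℘[L] z₀) = 0 := (L.eval_ΨSq_weierstrassP_eq_zero_iff hz₀ 3).mpr (by exact_mod_cast h3)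
  rw [WeierstrassCurve.ΨSq_three, eval_pow] at hΨ
  have hΨ₃ : L.curve.Ψ₃.eval (℘[L] z₀) = 0 := pow_eq_zero_iff two_ne_zero |>.mp hΨ
  simp only [WeierstrassCurve.Ψ₃, WeierstrassCurve.b₂, WeierstrassCurve.b₄, WeierstrassCurve.b₆, WeierstrassCurve.b₈,
    curve_a₁, curve_a₂, curve_a₃, curve_a₄, curve_a₆, eval_add, eval_mul, eval_pow, eval_C, eval_X, eval_ofNat] at hΨ₃
  linear_combination 4 * hΨ₃

/-! ### Vélu's lattice at `3` -/

/-- **Vélu's lattice at `3`.**  Let `z₀` be a third-period of `Λ` (`z₀ ∉ Λ`, `3z₀ ∈ Λ`), `x₀ = ℘_Λ(z₀)`, and let `Λ″` be any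
period lattice with the VÉLU INVARIANTS `g₂″ = 120x₀² − 9g₂`, `g₃″ = 280x₀³ − 42g₂x₀ − 27g₃` (those of the quotient of
`ℂ/Λ` by `{0, ±z₀}`, Silverman *AEC* III.4.12: `a' = a − 5t`, `b' = b − 7w`).  Then `Λ″ = Λ + ℤz₀`: `Λ ⊆ Λ″`, `z₀ ∈ Λ″`, and
every `w ∈ Λ″` lies in `Λ`, `z₀ + Λ` or `−z₀ + Λ`.  Proof: the certificate gives `Λ ⊆ Λ″` and `℘_{Λ″} = T(℘_Λ)` off the
lattices, `T = P/(X − x₀)²`; a point `w ∈ Λ″ ∖ Λ` has `Q(℘_Λ w) = 0`, i.e. `℘_Λ(w) = x₀`, i.e. `w ≡ ±z₀`; and `Λ″ ≠ Λ` since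
`T = id` would force `g₂ = 12x₀²`, `g₃ = −8x₀³`, `Δ(Λ) = 0`. [cite: SilvermanAEC2009, III.4.12–4.13 and Thm. VI.4.1]
[cite: Lawden1989, §9.8] -/
theorem lattice_eq_of_velu_three_invariants {z₀ : ℂ} (hz₀ : z₀ ∉ L.lattice) (h3 : 3 * z₀ ∈ L.lattice)
    (L'' : PeriodPair) (h₂ : L''.g₂ = 120 * ℘[L] z₀ ^ 2 - 9 * L.g₂)
    (h₃ : L''.g₃ = 280 * ℘[L] z₀ ^ 3 - 42 * L.g₂ * ℘[L] z₀ - 27 * L.g₃) :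
    L.lattice ≤ L''.lattice ∧ z₀ ∈ L''.lattice ∧
      ∀ w ∈ L''.lattice, w ∈ L.lattice ∨ w - z₀ ∈ L.lattice ∨ w + z₀ ∈ L.lattice := by
  classical
  set x₀ := ℘[L] z₀ with hx₀
  set h := L.g₂ / 2 with hh
  have hg₂ : L.g₂ = 2 * h := by rw [hh]; ring
  set P : ℂ[X] := X ^ 3 - C (2 * x₀) * X ^ 2 + C (7 * x₀ ^ 2 - h) * X - C (2 * x₀ ^ 3 + h * x₀ + L.g₃) with hP
  set Q : ℂ[X] := (X - C x₀) ^ 2 with hQ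
  have hQ0 : Q ≠ 0 := pow_ne_zero 2 (X_sub_C_ne_zero x₀)
  have hQdeg : Q.natDegree = 2 := by rw [hQ, natDegree_pow, natDegree_X_sub_C]
  have hPdeg : P.natDegree = 3 := by
    rw [hP]; compute_degree!
  have hnc : ∀ k : ℂ, P ≠ C k * Q := by
    intro k hk
    have hd := congrArg natDegree hk
    rw [hPdeg] at hd
    by_cases hk0 : k = 0
    · rw [hk0, map_zero, zero_mul, natDegree_zero] at hd; exact absurd hd (by norm_num)
    · rw [natDegree_C_mul hk0, hQdeg] at hd; exact absurd hd (by norm_num)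
  have hψ : 12 * x₀ ^ 4 - 12 * h * x₀ ^ 2 - 12 * L.g₃ * x₀ - h ^ 2 = 0 := by
    have e := L.twelve_mul_weierstrassP_pow_four_sub_eq_zero_of_three_mul_mem hz₀ h3
    rw [← hx₀, hg₂] at e
    linear_combination e
  have hid : (derivative P * Q - P * derivative Q) ^ 2 * (4 * X ^ 3 - C L.g₂ * X - C L.g₃) =
      Q * (4 * P ^ 3 - C L''.g₂ * P * Q ^ 2 - C L''.g₃ * Q ^ 3) := by
    rw [hg₂]
    exact velu_three_transformation_polynomial_identity hψ (by rw [h₂, hg₂]; ring) (by rw [h₃, hg₂]; ring)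
  -- (1) `Λ ⊆ Λ''`
  have hle : L.lattice ≤ L''.lattice := L.lattice_le_of_transformation_polynomial_identity L'' hQ0 hnc hid
  -- (2) `T(℘_Λ z) = ℘_{Λ''}(z)` off `Λ ∪ Λ''` where `Q(℘_Λ z) ≠ 0`
  obtain ⟨ε, hε, c, hc⟩ := L.exists_eq_weierstrassP_comp_of_transformation_polynomial_identity L'' hQ0 hnc hid
  have hcmem : c ∈ L''.lattice :=
    L.const_mem_lattice_of_eq_weierstrassP_comp L'' hQ0 (by rw [hQdeg, hPdeg]; norm_num) hc
  have h℘'' : ∀ z : ℂ, ℘[L''] (ε * z + c) = ℘[L''] z := by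
    intro z
    rw [L''.weierstrassP_add_coe (ε * z) ⟨c, hcmem⟩]
    rcases hε with rfl | rfl
    · rw [one_mul]
    · rw [neg_one_mul, L''.weierstrassP_neg]
  have hεc : ∀ z : ℂ, z ∉ L''.lattice → ε * z + c ∉ L''.lattice := by
    intro z hz h
    apply hz
    have h1 : ε * z ∈ L''.lattice := by
      have := sub_mem h hcmem
      rwa [add_sub_cancel_right] at this
    rcases hε with rfl | rfl
    · rwa [one_mul] at h1
    · rw [neg_one_mul] at h1
      simpa using neg_mem h1
  have hmul : ∀ z ∉ L''.lattice, z ∉ L.lattice → Q.eval (℘[L] z) ≠ 0 →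
      ℘[L''] z * Q.eval (℘[L] z) = P.eval (℘[L] z) := by
    intro z hz'' hz hQz
    rw [← h℘'' z, ← hc z hz hQz (hεc z hz''), div_mul_cancel₀ _ hQz]
  -- (3) every `w ∈ Λ'' ∖ Λ` lies in `±z₀ + Λ`
  have key : ∀ w ∈ L''.lattice, w ∈ L.lattice ∨ w - z₀ ∈ L.lattice ∨ w + z₀ ∈ L.lattice := by
    intro w hw''
    by_cases hw : w ∈ L.lattice
    · exact Or.inl hw
    right
    have hQw : Q.eval (℘[L] w) = 0 := L.eval_weierstrassP_eq_zero_of_mem_of_notMem L'' hmul hw'' hw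
    have hw℘ : ℘[L] w = ℘[L] z₀ := by
      have h0 : (℘[L] w - x₀) ^ 2 = 0 := by simpa [hQ] using hQw
      have h1 := pow_eq_zero_iff two_ne_zero |>.mp h0
      rw [hx₀] at h1
      exact sub_eq_zero.mp h1
    rcases (L.weierstrassP_eq_weierstrassP_iff hw hz₀).mp hw℘ with hs | hs
    · exact Or.inr hs
    · exact Or.inl hs
  -- (4) `Λ'' ≠ Λ`: else `T = id`, forcing `g₂ = 12x₀²`, `g₃ = −8x₀³`, `Δ(Λ) = 0`
  have hne : ∃ w ∈ L''.lattice, w ∉ L.lattice := by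
    by_contra! hall
    have hΛ : L.lattice = L''.lattice := le_antisymm hle fun w hw ↦ hall w hw
    have hT : ∀ x : ℂ, Q.eval x ≠ 0 → P.eval x / Q.eval x = x := by
      intro x hQx
      obtain ⟨z, hz, hzx⟩ := L.exists_weierstrassP_eq x
      have hz'' : z ∉ L''.lattice := fun h ↦ hz (hall z h)
      have h := hc z hz (by rw [hzx]; exact hQx) (hεc z hz'')
      rw [h℘'' z, ← PeriodPair.weierstrassP_eq_of_lattice_eq hΛ, hzx] at h
      exact h
    have hQ1 : Q.eval (x₀ + 1) = 1 := by simp [hQ]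
    have hQ2 : Q.eval (x₀ - 1) = 1 := by simp [hQ]
    have hP1 : P.eval (x₀ + 1) = (x₀ + 1) ^ 3 - 2 * x₀ * (x₀ + 1) ^ 2 + (7 * x₀ ^ 2 - h) * (x₀ + 1) -
        (2 * x₀ ^ 3 + h * x₀ + L.g₃) := by
      simp [hP]
    have hP2 : P.eval (x₀ - 1) = (x₀ - 1) ^ 3 - 2 * x₀ * (x₀ - 1) ^ 2 + (7 * x₀ ^ 2 - h) * (x₀ - 1) -
        (2 * x₀ ^ 3 + h * x₀ + L.g₃) := by
      simp [hP]
    have e1 := hT (x₀ + 1) (by rw [hQ1]; exact one_ne_zero)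
    have e2 := hT (x₀ - 1) (by rw [hQ2]; exact one_ne_zero)
    rw [hQ1, div_one, hP1] at e1
    rw [hQ2, div_one, hP2] at e2
    have hh6 : h = 6 * x₀ ^ 2 := by linear_combination (e2 - e1) / 2
    have hg₃ : L.g₃ = -8 * x₀ ^ 3 := by
      rw [hh6] at e1
      linear_combination -e1
    apply L.discr_ne_zero
    rw [hg₂, hh6, hg₃]; ring
  obtain ⟨w, hw'', hw⟩ := hne
  have hz₀'' : z₀ ∈ L''.lattice := by
    rcases key w hw'' with h0 | h0 | h0
    · exact absurd h0 hw
    · have e : z₀ = w - (w - z₀) := by ring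
      rw [e]
      exact sub_mem hw'' (hle h0)
    · have e : z₀ = (w + z₀) - w := by ring
      rw [e]
      exact sub_mem (hle h0) hw''
  exact ⟨hle, hz₀'', key⟩

end PeriodPair

end
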